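import Summits.QuantumFields.YangMills.Theses.FradkinShenkerFlow
import Summits.QuantumFields.YangMills.Theses.EquipartitionCriticality
import Summits.QuantumFields.YangMills.Theses.DirichletWindow
import Literature.Probability.LatticeModels.OSReconstruction
import Literature.MathematicalPhysics.QuantumFieldTheory.LatticeMassGap
import Literature.MathematicalPhysics.QuantumFieldTheory.QCDSlabFunctional
import Literature.MathematicalPhysics.QuantumLattice.LatticeGaugeDLR
import Summits.QuantumFields.YangMills.Theorems.ClusteringToYangMills.Negative.DisproofBurden
import HarnessLib.Audit

/-!
# Line `spectral-requantisation-dock` — crux `ClusteringToYangMills` (stmt-QuantumFields-9443)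

Skeleton of the line "re-quantise H through the Osterwalder–Seiler transfer matrix, then dock"
for the crux `Summit.QuantumFields.YangMills.Theses.FradkinShenkerFlow.ClusteringToYangMills`
(`H → YangMills`, `H` = for every compact simple `G` and faithful `r` there is `β₀` with
volume-uniform exponential clustering in Euclidean time on the symmetric odd tori `(ℤ/(2S+1))⁴`
at every `β ≥ β₀`: `∃ m(β) > 0 ∀ A B ∃ C(A,B,β) ∀ S ∀ n ≤ S, |corr| ≤ C e^{-m n}`).

## The line in one paragraph

The crux is, by a CHECKED dock, the conjunction of three items that already exist and are staffed
on sibling routes — `DirichletWindow.XiDiverges` (8941), `DirichletWindow.CriticalityOfXiDiverges`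
(12318), `EquipartitionCriticality.CriticalContinuumLimit` (8762, the canonical UV/OS leg) — and ONE
adapter: H's per-`β` shape `∃ m ∀ A B ∃ C(A,B,β)` must become the `β`-UNIFORM large-torus shape
`∃ β₁ m(·) S₀(·), ∀ A B ∃ C(A,B) ∀ β ≥ β₁ ∀ S ≥ S₀(β) ∀ n ≤ S` consumed by 8762 (hypothesis 1).
This line earns the `β`-uniformity SPECTRALLY (not by `β`-regularity bookkeeping): the constants
become the structural OS constants `K ‖A‖∞ ‖B‖∞ e^{c_A + c_B}` (`c` = time extent of the support)
and the rate becomes a fixed fraction of the TRUE infinite-volume gap `m_∞(β) ≥ m_H(β)` — the rate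
8762's prover needs for scale pinning (`a_k ≍ 1/ξ(β_k)`, barrier `FixedCouplingUltralocality`).
Four registered stubs, each a statement about Wilson's lattice theory at ONE coupling `β`:

* `stub_requantise` (RQ, infinite volume, M/L, provable now in principle): H at `β` with rate `m`
  ⟹ every infinite-volume limit state `μ` of the odd symmetric tori is Osterwalder–Schrader
  reconstructible for the bond time reflection (tree `IsOSReconstructible`: RP, RP half a step up,
  reflection/translation invariance pass to the limit) and its transfer data have `HasMassGap m`
  (Glimm–Jaffe 6.1.3 in dense form: `⟨v, Tᵗv⟩ ≤ C_v e^{-mt}` on the dense set of local gauge-invariant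
  vectors puts every spectral measure in `[0, e^{-m}]`; gauge reduction `ι F = ι (PF)` is automatic for
  the bond reflection).  Output `HasInfiniteVolumeGap r β m`.
* `stub_gapStability` (GV, "gapped in the box", L/open): the infinite-volume gap `m ≤ 1` forces the
  zero-temperature CYLINDER states `∞ × (ℤ/(2S+1))³` (limits `M → ∞` of the asymmetric tori
  `M × (2S+1)³`, tree `SlabGauge.*`) to have transfer-operator gap `≥ m/2` on their whole OS space
  (= the physical Hilbert space of the spatial 3-torus, torelon/flux sectors included) once
  `S ≥ S₀(β)` — Lüscher's exponentially small finite-size mass shifts; `S₀(β)` is ours and may be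
  `≫ ξ(β)`.  Output `CylGap r β (2S+1) (m/2)`.
* `stub_thermalMultiplicity` (T¼ — the card's (T½) at the aspect the torus clause really needs —
  "cold at a quarter of the period", L/open, the card's ONLY genuinely new input): with a `β`-FREE
  `K`, the thermal multiplicity of the spatial 3-torus of side `N = 2S+1`,
  `ζ_β(M, N³) = Z_β(M × N³)/λ₀(β,N)^M = Tr t^M = 1 + Σ_{i≥1} x_i^M` (`t = T_V/λ₀`, `λ₀ = lim Z^{1/M}`),
  stays `≤ 1 + K` for all aspect ratios `M/N ≥ 1/4` and `S ≥ S₁(β)` — a dilute-glueball-gas bound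
  (one glueball in volume `N³` at inverse temperature `N/4`: `(mN)^{3/2} e^{-mN/4} → 0`); stated over
  slab partition functions only.  Triage r1-1's sharpening (aspect strictly below `1/2` because the
  complementary period is `N - n - c ≥ S + 1 - c`, not `⌈N/2⌉`) is why the aspect is `1/4`.
* `stub_blockDecomposition` (BD, M/L, the certified mechanism): transfer-matrix re-quantisation of
  the SYMMETRIC torus — `⟨A τₙB⟩_{N⁴} = Tr(t^{N-n-c_B} Â t^{n-c_A} B̂)/ζ(N)`; vacuum rows decay at the
  cylinder gap, the off-vacuum block is `≤ ‖Â‖‖B̂‖ e^{-(m/2)(n-c_A)} ζ'(N-n-c_B)` (row sums ≤ operator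
  norms, `x_j ≤ e^{-m/2}`), the disconnected `ζ'(N)`-corrections are `≤ e^{-(m/2)(3N/4)} (1+K)`, and
  supports wider than `S/2` are absorbed by the a-priori bound — so `CylGap (m/2)` + the thermal bound
  give the torus atom of 8762's hypothesis 1 with rate `m/4` and constants
  `K' (1+K)² ‖A‖∞‖B‖∞ e^{c_A+c_B}`, `K'` depending on `(G, r)` only.
`ClusteringToYangMills_of` composes (kernel-checked, no `sorry`): for `β ≥ max β₀ 0` re-quantise
at H's rate (RQ), pass to the SPECTRAL rate `m_*(β) = mStar r β` (the supremum of admissible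
infinite-volume gaps `≤ 1`; the gap condition is closed, `ivGap_mStar`), run GV → T¼ → BD at `m_*`,
assemble `UniformTorusGap` (`m(β) := m_*(β)/4`, `S₀(β) := max S₀ S₁`, `C(A,B)` `β`-free), then
`CriticalContinuumLimit` with criticality fed by `CriticalityOfXiDiverges XiDiverges`.  The rate that
reaches 8762 is thus tied BY CONSTRUCTION to the true inverse correlation length, not to the rate H
happens to carry (on this route H comes from a heat-bath Poincaré constant, dynamic exponent `z = 2`).

## Lead's reshape (line lead, cycle 1): `stub_requantise` split into four registered stubs

RQ as one piece is XL in Lean, so it is cut along its proof: `stub_cylinderApprox` (pure measure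
theory on the compact configuration space `G^{edges}`: `L²`-approximation of bounded positive-time
measurable functions by CONTINUOUS positive-time cylinder functions, and determination of
probability measures by their continuous-cylinder integrals), `stub_reconstructible` (odd-torus
limit states satisfy `IsOSReconstructible` for the bond reflection `x₀ ↦ -1-x₀`, the unit time
shift and `𝓔₊`: RP and RP-half-a-step-up from `wilsonExpectation_oddReflectionPositive` passed to
the limit on continuous cylinder functions and extended by the approximation property; reflection /
translation invariance of limit states), `stub_osDensity` (the OS images of complex combinations of
continuous positive-time gauge-invariant local observables are dense in the OS space — gauge
averaging is invisible to the OS map because the two halves are site-disjoint), and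
`stub_gapFromClustering` (H at `β` with rate `m` on that dense set ⟹ `HasMassGap m`, by the tree's
`gapNorm_le_exp_of_dense_clustering`); `stub_requantise` is now their checked composition.

## Disproof used (Cruxes/ClusteringToYangMills/Disproof.lean, cdisprove gen 1 cycle 1, RESISTS)

No `_false_without_` theorem and no `-- Targets` exist yet.  Honoured: §1 `ecPerVolume_trivial` /
landed `Negative.clustering_perVolume` (the order `∃ C ∀ S` is the content) — BD's constants are
`β`-free AND `S`-free and structured; §1 `not_ecAllTimes` / landed `Negative.not_latticeClusteringAllTimes`
(`n ≤ S` load-bearing) — every torus statement here keeps `n ≤ S` (the thermal wrap-around is exactly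
what T¼ pays for), all-times clustering appears only for INFINITE-volume / cylinder states where it is
true; §1 `ec_zero_coupling` / `Negative.clustering_zero_coupling` — at `β = 0` all four stubs hold
(`T` = vacuum projection, `ζ ≡ 1`, `K = 0`); §2 `yangMillsWithoutNontriviality` — the interacting
continuum limit is relocated, by name, into 8762 (+ criticality 12318/8941), not claimed here.
The landed Negative file `Theorems/ClusteringToYangMills/Negative/DisproofBurden.lean` is imported.
-/

noncomputable section

open scoped BigOperators Topology ENNReal
open MeasureTheory Filter
open Literature.MathematicalPhysics.QuantumFieldTheory Literature.MathematicalPhysics.QuantumLattice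
open Literature.Probability.LatticeModels (IsOSReconstructible IsBoundedMeasurable positiveEvents
  TransferData)

/-! ## PASTED VOCABULARY — verbatim copy of the proposed Literature module
`Literature/MathematicalPhysics/QuantumFieldTheory/GaugeOSData.lean` (p76738, in review).
Delete this section and `import Literature.MathematicalPhysics.QuantumFieldTheory.GaugeOSData`
once it lands; all fully-qualified names are final. -/

namespace Literature.MathematicalPhysics.QuantumFieldTheory

open Literature.MathematicalPhysics.QuantumLattice Literature.Probability.LatticeModels

/-! ### Time reflection, time shift, positive-time events for gauge fields on `ℤ⁴` -/

section Geometry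

variable {G : Type}

/-- **Bond time reflection of `ℤ⁴` gauge fields** induced by the site reflection
`θ : x₀ ↦ -1 - x₀` (`latticeTimeReflection 4`, plane `x₀ = -1/2`): a spatial link `(x, i)`,
`i ≠ 0`, reads `U (θx, i)`; the temporal link `(x, 0)` from `x` to `x + e₀` reads the INVERSE of
the temporal link based at `θ(x + e₀) = θx - e₀` (the reflected link, traversed backwards).
`Θ` is an involution exchanging the links based at times `≥ 0` with links lying at times `≤ -1`.
[cite: OsterwalderSeiler1978, §2] -/
def gaugeTimeReflect [Group G] (U : LGConfig 4 G) : LGConfig 4 G := fun e =>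
  if e.2 = 0 then (U (latticeTimeReflection 4 (e.1 + Pi.single 0 1), 0))⁻¹
  else U (latticeTimeReflection 4 e.1, e.2)

/-- Pointwise formula for `gaugeTimeReflect`. [cite: OsterwalderSeiler1978, §2] -/
theorem gaugeTimeReflect_apply [Group G] (U : LGConfig 4 G) (e : ZdEdge 4) :
    gaugeTimeReflect U e =
      if e.2 = 0 then (U (latticeTimeReflection 4 (e.1 + Pi.single 0 1), 0))⁻¹
      else U (latticeTimeReflection 4 e.1, e.2) := rfl

/-- **Unit Euclidean time shift of `ℤ⁴` gauge fields**, `(τU)(x, i) = U(x + e₀, i)`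
(`configShift (-e₀)`; with the OS convention `ι (F ∘ τ) = T (ι F)` an observable localised at
times `≥ 0` is sent to one localised at times `≥ 1`; it is the translation composed with the
second observable of `latticeConnectedCorr`). [cite: GlimmJaffe1987, §6.1] -/
def gaugeTimeShift [MeasurableSpace G] : LGConfig 4 G → LGConfig 4 G :=
  configShift (G := G) (-(Pi.single (0 : Fin 4) (1 : ℤ)))

/-- `gaugeTimeShift U (x, i) = U (x + e₀, i)`. [cite: GlimmJaffe1987, §6.1] -/
@[simp] theorem gaugeTimeShift_apply [MeasurableSpace G] (U : LGConfig 4 G) (e : ZdEdge 4) :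
    gaugeTimeShift U e = U (e.1 + Pi.single 0 1, e.2) := by
  simp [gaugeTimeShift, sub_neg_eq_add]

/-- **Positive-time links**: those based at sites with `0 ≤ x₀` (spatial links at times `≥ 0`,
temporal links from `t ≥ 0` upwards; the temporal links from `-1` to `0` belong to neither half).
[cite: OsterwalderSeiler1978, §2] -/
def posTimeEdges : Set (ZdEdge 4) := {e | 0 ≤ e.1 0}

/-- Membership in `posTimeEdges`. [cite: OsterwalderSeiler1978, §2] -/
@[simp] theorem mem_posTimeEdges {e : ZdEdge 4} : e ∈ posTimeEdges ↔ 0 ≤ e.1 0 := Iff.rfl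

variable (G) in
/-- **The positive-time σ-algebra `𝓔₊`** of gauge fields: cylinder events of `posTimeEdges`
(Mathlib `cylinderEvents`, through the tree's `positiveEvents`). [cite: GlimmJaffe1987, §6.1] -/
abbrev posTimeEvents [MeasurableSpace G] : MeasurableSpace (LGConfig 4 G) :=
  positiveEvents (S := G) posTimeEdges

end Geometry

/-! ### Odd-torus limit states, torus clustering, infinite-volume gap -/

section States

variable {G : Type} [Group G] [MeasurableSpace G] [TopologicalSpace G] [IsTopologicalGroup G]
  [CompactSpace G] [BorelSpace G]

/-- **Infinite-volume limit states along ODD symmetric tori** `(ℤ/(2S_k+1))⁴`, `S_k` strictly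
increasing (tree `IsInfiniteVolumeLimitAlong` with sides `L_k + 1 = 2 S_k + 1`): the tori on which
torus clustering hypotheses `n ≤ S` are stated. [cite: arXiv180301950, §2] -/
def oddTorusLimitPoints (r : LatticeRep G) (β : ℝ) : Set (Measure (LGConfig 4 G)) :=
  {μ | ∃ S : ℕ → ℕ, StrictMono S ∧ IsInfiniteVolumeLimitAlong (d := 4) r.ρ β (fun k => 2 * S k) μ}

/-- **Volume-uniform Euclidean-time clustering at coupling `β` with rate `m`**: for every pair of
gauge-invariant local observables a constant `C(A, B)` such that on EVERY odd symmetric torus of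
side `2S+1` and for all time separations `n ≤ S`,
`|⟨A · τ_{n e₀} B⟩_{β,2S+1} − ⟨A⟩⟨B⟩| ≤ C e^{-m n}` (the atom of `HasLatticeMassGap`;
Jaffe–Witten §5 "uniform gap for finite-volume approximations"). [cite: arXiv180301950, §5 Problem 5.1] -/
def TorusClusteringAt (r : LatticeRep G) (β m : ℝ) : Prop :=
  ∀ A B : YMSpecies G, ∃ C : ℝ, ∀ S n : ℕ, n ≤ S →
    |latticeConnectedCorr r.ρ β (2 * S + 1) A.F B.F n| ≤ C * Real.exp (-(m * n))

/-- **Infinite-volume transfer gap `≥ m` at coupling `β`**: every odd-torus limit state is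
Osterwalder–Schrader reconstructible for the bond time reflection, the unit time shift and `𝓔₊`
(tree `IsOSReconstructible`: RP, RP half a step up, hermitian and shift symmetry), and its
reconstructed transfer data satisfy `‖T|_{Ω^⊥}‖ ≤ e^{-m}` (tree `TransferData.HasMassGap`)
(Osterwalder–Seiler 1978 §2; Glimm–Jaffe 1987 Thm. 6.1.3). [cite: OsterwalderSeiler1978, §2] -/
def HasInfiniteVolumeGap (r : LatticeRep G) (β m : ℝ) : Prop :=
  ∀ (μ : Measure (LGConfig 4 G)) [IsProbabilityMeasure μ], μ ∈ oddTorusLimitPoints r β →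
    ∃ h : IsOSReconstructible μ gaugeTimeReflect gaugeTimeShift (posTimeEvents G),
      h.transferData.HasMassGap m

end States

/-! ### Measure-theoretic side conditions on the configuration space -/

section MeasureTheory

variable {G : Type} [MeasurableSpace G] [TopologicalSpace G]

/-- **Approximation property of a measure on `ℤ⁴` gauge fields**: every bounded
`𝓔₊`-measurable complex observable is an `L²(μ)`-limit of CONTINUOUS bounded cylinder
observables supported on finitely many positive-time links (and again `𝓔₊`-measurable). For a
probability measure on the compact metrisable configuration space this always holds (`𝓔₊` is
generated by the positive-time coordinates; continuous functions are dense in `L²` of a finite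
Borel measure on `G^Λ`). [cite: GlimmJaffe1987, §6.1] -/
def CylinderApprox (μ : Measure (LGConfig 4 G)) : Prop :=
  ∀ F : LGConfig 4 G → ℂ, IsBoundedMeasurable (posTimeEvents G) F → ∀ ε : ℝ, 0 < ε →
    ∃ (F' : LGConfig 4 G → ℂ) (Λ : Finset (ZdEdge 4)), (↑Λ : Set (ZdEdge 4)) ⊆ posTimeEdges ∧
      IsCylinder F' Λ ∧ Continuous F' ∧ Measurable[posTimeEvents G] F' ∧
        (∃ C : ℝ, ∀ U, ‖F' U‖ ≤ C) ∧ ∫ U, ‖F U - F' U‖ ^ 2 ∂μ ≤ ε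

variable (G) in
/-- **Probability measures on `ℤ⁴` gauge fields are determined by their integrals of bounded
continuous real cylinder observables** (as a property of `G`; true for compact metrisable `G` by
Stone–Weierstrass on the compact configuration space and uniqueness of finite Borel measures).
[cite: GlimmJaffe1987, §6.1] -/
def CylinderExt : Prop :=
  ∀ (μ ν : Measure (LGConfig 4 G)) [IsProbabilityMeasure μ] [IsProbabilityMeasure ν],
    (∀ (F : LGConfig 4 G → ℝ) (Λ : Finset (ZdEdge 4)), IsCylinder F Λ → Continuous F →
      (∃ C : ℝ, ∀ U, |F U| ≤ C) → ∫ U, F U ∂μ = ∫ U, F U ∂ν) → μ = ν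

variable (G) in
/-- **The continuous positive-time species** (`G` a group) as complex observables: `U ↦ (A.F U : ℂ)` for a
gauge-invariant local observable `A : YMSpecies G` with `A.F` continuous and `A.supp ⊆ posTimeEdges`
(the generating set of the OS space of a gauge-invariant state). [cite: OsterwalderSeiler1978, §2] -/
def contPosTimeObs [Group G] : Set (LGConfig 4 G → ℂ) :=
  {F | ∃ A : YMSpecies G, Continuous A.F ∧ (↑A.supp : Set (ZdEdge 4)) ⊆ posTimeEdges ∧
    F = fun U => (A.F U : ℂ)}

end MeasureTheory

end Literature.MathematicalPhysics.QuantumFieldTheory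

namespace Summit.QuantumFields.YangMills.Cruxes.ClusteringToYangMills.SpectralRequantisationDock

/-- Odd torus sides are never zero. -/
instance instNeZeroOddSide (S : ℕ) : NeZero (2 * S + 1) := ⟨Nat.succ_ne_zero _⟩

/-- Sites of `ℤ⁴` (time = coordinate `0`). -/
local notation "Site4" => Literature.Probability.LatticeModels.Site 4

/-- Positively oriented edges of `ℤ⁴`. -/
local notation "Edge4" => Literature.MathematicalPhysics.QuantumLattice.ZdEdge 4

section Defs

variable {G : Type} [Group G] [TopologicalSpace G] [IsTopologicalGroup G] [CompactSpace G]
  [MeasurableSpace G] [BorelSpace G]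

/-! ### H at one coupling, and the Euclidean-time structure of `ℤ⁴` gauge configurations -/

/-! ### Asymmetric tori `ℤ_M × (ℤ/N)³` (tree `SlabGauge`) and zero-temperature cylinder states -/

/-- Sites of `ℤ⁴` ↦ sites of the slab `ℤ_M × (ℤ/N)³`: time (coordinate `0`) ↦ the circle `ℤ_M`,
space ↦ the periodic box. -/
def slabSite (M N : ℕ) (y : Site4) : SlabGauge.Site 3 M N :=
  (((y 0 : ℤ) : ZMod M), fun i : Fin 3 => ((y i.succ : ℤ) : ZMod N))

/-- Directions of `ℤ⁴` ↦ slab directions: `0 ↦ none` (the circle = Euclidean time), `i+1 ↦ some i`. -/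
def slabDir (i : Fin 4) : SlabGauge.Dir 3 := finSuccEquiv 3 i

/-- The `(M; N, N, N)`-periodic lift of a slab gauge field to `ℤ⁴`. -/
def slabLift (M N : ℕ) (U : SlabGauge.Config 3 M N G) : LGConfig 4 G :=
  fun e => U (slabSite M N e.1, slabDir e.2)

/-- The Wilson partition function of the asymmetric torus `M × N³` at coupling `β` (isotropic
`SlabGauge.weight ρ β β = exp (β Σ_P Re tr ρ(U_P))`, normalised Haar; `= Tr T_{V_N}^M`, `T_{V_N} ≥ 0` the
Osterwalder–Seiler transfer matrix of the spatial 3-torus, for every `M ≥ 1`). -/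
def slabZ (r : LatticeRep G) (β : ℝ) (M N : ℕ) [NeZero M] [NeZero N] : ℝ :=
  ∫ U, SlabGauge.weight r.ρ β β U ∂(SlabGauge.haar 3 M N G)

/-- Normalised expectation of the asymmetric torus `M × N³`. -/
def slabExpect (r : LatticeRep G) (β : ℝ) (M N : ℕ) [NeZero M] [NeZero N]
    (F : SlabGauge.Config 3 M N G → ℝ) : ℝ :=
  (∫ U, F U * SlabGauge.weight r.ρ β β U ∂(SlabGauge.haar 3 M N G)) / slabZ r β M N

/-- `ω` is the limit of the asymmetric torus states `(M_k + 1) × N³`, `k → ∞`, on bounded continuous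
cylinder observables of `ℤ⁴` (through the periodic lift) — the zero-temperature cylinder state
`∞ × (ℤ/N)³` lifted to `ℤ⁴` (spatially `N`-periodic configurations a.s.). -/
def IsCylinderLimitAlong (r : LatticeRep G) (β : ℝ) (N : ℕ) [NeZero N] (M : ℕ → ℕ)
    (ω : Measure (LGConfig 4 G)) : Prop :=
  IsProbabilityMeasure ω ∧
    ∀ (F : LGConfig 4 G → ℝ) (Λ : Finset Edge4), IsCylinder F Λ → Continuous F →
      (∃ C, ∀ U, |F U| ≤ C) →
        Tendsto (fun k : ℕ => slabExpect r β (M k + 1) N (F ∘ slabLift (M k + 1) N)) atTop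
          (𝓝 (∫ U, F U ∂ω))

/-- Zero-temperature cylinder states of the spatial torus of side `N` (limit points `M → ∞`; the
transfer-matrix picture makes the limit unique — the vacuum state of `T_{V_N}` — which is part of what
the stubs' provers establish, not assumed). -/
def cylinderLimitPoints (r : LatticeRep G) (β : ℝ) (N : ℕ) [NeZero N] : Set (Measure (LGConfig 4 G)) :=
  {ω | ∃ M : ℕ → ℕ, StrictMono M ∧ IsCylinderLimitAlong r β N M ω}

/-- **`CylGap r β N m` — "gapped in the box"**: every zero-temperature cylinder state of the spatial
torus of side `N` is OS-reconstructible for `(Θ, τ, 𝓔₊)` with transfer gap `≥ m`.  Its OS space is the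
whole physical Hilbert space of the spatial 3-torus (time-zero multiplication operators on the
positive vacuum are dense), electric-flux / torelon sectors included — so this IS the statement
`x_i ≤ e^{-m}` for every normalised eigenvalue `x_i = λ_i/λ₀`, `i ≥ 1`, of `T_{V_N}`. -/
def CylGap (r : LatticeRep G) (β : ℝ) (N : ℕ) [NeZero N] (m : ℝ) : Prop :=
  ∀ (ω : Measure (LGConfig 4 G)) [IsProbabilityMeasure ω], ω ∈ cylinderLimitPoints r β N →
    ∃ h : IsOSReconstructible ω gaugeTimeReflect gaugeTimeShift (posTimeEvents G), h.transferData.HasMassGap m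

/-- The top eigenvalue `λ₀(β, N)` of the transfer matrix of the spatial torus of side `N`, defined
WITHOUT operators as `lim inf_M Z_β((M+1) × N³)^{1/(M+1)}` (`‖λ‖_{ℓ^M} ↓ ‖λ‖_∞`: it is the limit). -/
def lambda0 (r : LatticeRep G) (β : ℝ) (N : ℕ) [NeZero N] : ℝ :=
  Filter.liminf (fun M : ℕ => (slabZ r β (M + 1) N) ^ (((M : ℝ) + 1)⁻¹)) atTop

/-- **Thermal multiplicity** `ζ_β(M, N³) = Z_β(M × N³)/λ₀^M = Tr t^M = 1 + Σ_{i ≥ 1} x_i^M` of the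
spatial torus of side `N` at inverse temperature `M` (`t = T/λ₀`); `ζ - 1` is the thermal weight of
everything above the vacuum. -/
def slabZeta (r : LatticeRep G) (β : ℝ) (M N : ℕ) [NeZero M] [NeZero N] : ℝ :=
  slabZ r β M N / (lambda0 r β N) ^ M

/-- Time extent of a local observable: `1 +` the largest `|x₀|` over the base points of its support
(so `A.F` reads only links inside the time slab `[-c, c]`, `c = timeExtent A`). -/
def timeExtent (A : YMSpecies G) : ℕ := A.supp.sup (fun e => (e.1 0).natAbs) + 1

/-- The `β`-UNIFORM large-torus shape of the lattice gap for one `(G, r)` — verbatim the body of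
`EquipartitionCriticality.LatticeGapLargeBeta` / hypothesis 1 of `CriticalContinuumLimit` (8762). -/
def UniformTorusGap (r : LatticeRep G) : Prop :=
  ∃ (β₁ : ℝ) (m : ℝ → ℝ) (S₀ : ℝ → ℕ), (∀ β : ℝ, β₁ ≤ β → 0 < m β) ∧
    ∀ A B : YMSpecies G, ∃ C : ℝ, ∀ β : ℝ, β₁ ≤ β → ∀ S n : ℕ, S₀ β ≤ S → n ≤ S →
      |latticeConnectedCorr r.ρ β (2 * S + 1) A.F B.F n| ≤ C * Real.exp (-(m β * n))


end Defs

/-! ### The registered stubs (statements) -/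

namespace Statement

/-- Stub RQ0 — **measure theory on the configuration space**: for a compact simple (hence
second-countable, metrisable) `G`, every probability measure on `LGConfig 4 G` has the
approximation property `CylinderApprox`, and probability measures are determined by their
continuous-cylinder integrals (`CylinderExt`). -/
def stub_cylinderApprox : Prop :=
  ∀ (G : Type) [Group G] [TopologicalSpace G] [IsTopologicalGroup G] [CompactSpace G]
    [MeasurableSpace G] [BorelSpace G], IsCompactSimpleLieGroup G →
      (∀ (μ : Measure (LGConfig 4 G)) [IsProbabilityMeasure μ], CylinderApprox μ) ∧ CylinderExt G

/-- Stub RQa — **odd-torus limit states are OS-reconstructible** for the bond time reflection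
`gaugeTimeReflect` (`x₀ ↦ -1 - x₀`), the unit time shift `gaugeTimeShift` and the positive-time
σ-algebra `posEvents`: RP (`wilsonExpectation_oddReflectionPositive`, translated by one unit) and
RP half a step up (the same theorem conjugated to the site reflection `x₀ ↦ -x₀`:
`gaugeTimeReflect = gaugeTimeShift ∘ Θ₀`) pass to the limit on continuous cylinder observables and extend
to bounded `𝓔₊`-measurable ones by `CylinderApprox`; hermitian symmetry and shift symmetry are
reflection / translation invariance of the limit state (`CylinderExt`). -/
def stub_reconstructible : Prop :=
  ∀ (G : Type) [Group G] [TopologicalSpace G] [IsTopologicalGroup G] [CompactSpace G]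
    [MeasurableSpace G] [BorelSpace G], IsCompactSimpleLieGroup G →
      ∀ (r : LatticeRep G) (β : ℝ), 0 ≤ β →
        ∀ (μ : Measure (LGConfig 4 G)) [IsProbabilityMeasure μ], μ ∈ oddTorusLimitPoints r β →
          CylinderApprox μ → CylinderExt G →
            IsOSReconstructible μ gaugeTimeReflect gaugeTimeShift (posTimeEvents G)

/-- Stub RQb1 — **OS density of the continuous gauge-invariant positive-time observables**: for an
odd-torus limit state `μ` with the approximation property, the OS images of the complex span of
`contPosTimeObs` are dense in the OS Hilbert space (`ι F = ι (P F)` for the gauge average `P` over the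
sites of non-negative time, which do not touch `F ∘ Θ`; gauge invariance of `μ` on continuous
cylinder functions passes to the limit from `wilsonMeasure_map_gaugeTransform`). -/
def stub_osDensity : Prop :=
  ∀ (G : Type) [Group G] [TopologicalSpace G] [IsTopologicalGroup G] [CompactSpace G]
    [MeasurableSpace G] [BorelSpace G], IsCompactSimpleLieGroup G →
      ∀ (r : LatticeRep G) (β : ℝ), 0 ≤ β →
        ∀ (μ : Measure (LGConfig 4 G)) [IsProbabilityMeasure μ], μ ∈ oddTorusLimitPoints r β →
          CylinderApprox μ →
            ∀ h : IsOSReconstructible μ gaugeTimeReflect gaugeTimeShift (posTimeEvents G),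
              Dense (h.osMap '' (Submodule.span ℂ (contPosTimeObs G) : Set (LGConfig 4 G → ℂ)))

/-- Stub RQb2 — **the gap from H on the dense set** (Glimm–Jaffe 6.1.3 / 19.7.1 in dense form,
tree `gapNorm_le_exp_of_dense_clustering`): H at `β` with rate `m` bounds
`⟪v, Tᵗ v⟫ - |⟪Ω, v⟫|²` by `C_v e^{-mt}` for every `v` in the OS image of the span of `contPosTimeObs`
(pass the torus correlations of the continuous cylinder observables `A ∘ Θ`, `B ∘ τᵗ` to the
limit state; `t ≤ S_k` eventually), hence `‖T P_{Ω^⊥}‖ ≤ e^{-m}`. -/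
def stub_gapFromClustering : Prop :=
  ∀ (G : Type) [Group G] [TopologicalSpace G] [IsTopologicalGroup G] [CompactSpace G]
    [MeasurableSpace G] [BorelSpace G], IsCompactSimpleLieGroup G →
      ∀ (r : LatticeRep G) (β m : ℝ), 0 ≤ β → 0 < m → TorusClusteringAt r β m →
        ∀ (μ : Measure (LGConfig 4 G)) [IsProbabilityMeasure μ], μ ∈ oddTorusLimitPoints r β →
          ∀ h : IsOSReconstructible μ gaugeTimeReflect gaugeTimeShift (posTimeEvents G),
            Dense (h.osMap '' (Submodule.span ℂ (contPosTimeObs G) : Set (LGConfig 4 G → ℂ))) →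
              h.transferData.HasMassGap m

/-- RQ (no longer a registered stub: the composition of RQ0, RQa, RQb1, RQb2, proved below) —
**infinite-volume spectral re-quantisation**: H at `β` (rate `m`, per-pair constants,
all odd tori, `n ≤ S`) ⟹ every odd-torus limit state is OS-reconstructible with transfer gap `≥ m`. -/
def stub_requantise : Prop :=
  ∀ (G : Type) [Group G] [TopologicalSpace G] [IsTopologicalGroup G] [CompactSpace G]
    [MeasurableSpace G] [BorelSpace G], IsCompactSimpleLieGroup G →
      ∀ (r : LatticeRep G) (β m : ℝ), 0 ≤ β → 0 < m → TorusClusteringAt r β m → HasInfiniteVolumeGap r β m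

/-- Stub GV — **finite-volume gap stability** ("gapped in the box"): an infinite-volume gap `m ≤ 1`
(H at `β`, at its own rate `m_H`, still available) forces transfer gap `≥ m/2` for the
zero-temperature cylinder states of all spatial tori of side `2S+1 ≥ 2S₀(β)+1`. -/
def stub_gapStability : Prop :=
  ∀ (G : Type) [Group G] [TopologicalSpace G] [IsTopologicalGroup G] [CompactSpace G]
    [MeasurableSpace G] [BorelSpace G], IsCompactSimpleLieGroup G →
      ∀ (r : LatticeRep G) (β mH m : ℝ), 0 ≤ β → 0 < mH → TorusClusteringAt r β mH →
        0 < m → m ≤ 1 → HasInfiniteVolumeGap r β m →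
          ∃ S₀ : ℕ, ∀ S : ℕ, S₀ ≤ S → CylGap r β (2 * S + 1) (m / 2)

/-- Stub T¼ — **thermal multiplicity at aspect ratio ≥ 1/4** ("cold at a quarter of the period"):
with a constant `K` depending on `(G, r)` ONLY, for all large spatial tori `N = 2S+1 ≥ 2S₁(β)+1` and
all `M + 1 ≥ N/4`, `ζ_β(M+1, N³) ≤ 1 + K` (given H at `β` at its own rate, the infinite-volume gap
`m ≤ 1` and the cylinder gaps `m/2` beyond `S₀`). -/
def stub_thermalMultiplicity : Prop :=
  ∀ (G : Type) [Group G] [TopologicalSpace G] [IsTopologicalGroup G] [CompactSpace G]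
    [MeasurableSpace G] [BorelSpace G], IsCompactSimpleLieGroup G →
      ∀ (r : LatticeRep G), ∃ K : ℝ, 0 ≤ K ∧
        ∀ (β mH m : ℝ) (S₀ : ℕ), 0 ≤ β → 0 < mH → TorusClusteringAt r β mH →
          0 < m → m ≤ 1 → HasInfiniteVolumeGap r β m →
          (∀ S : ℕ, S₀ ≤ S → CylGap r β (2 * S + 1) (m / 2)) →
            ∃ S₁ : ℕ, ∀ S : ℕ, S₁ ≤ S → ∀ M : ℕ, 2 * S + 1 ≤ 4 * (M + 1) →
              slabZeta r β (M + 1) (2 * S + 1) ≤ 1 + K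

/-- Stub BD — **transfer-matrix block decomposition of the symmetric torus**: the cylinder gap `m/2`
and the thermal bound `1 + K` at aspect `≥ 1/4` give the atoms of 8762's hypothesis 1 on every large
symmetric odd torus with rate `m/4` and the STRUCTURED, `β`-free constants
`K' (1+K)² C_A C_B e^{c_A + c_B}` (`K'` depends on `(G, r)` only; `c` = `timeExtent`). -/
def stub_blockDecomposition : Prop :=
  ∀ (G : Type) [Group G] [TopologicalSpace G] [IsTopologicalGroup G] [CompactSpace G]
    [MeasurableSpace G] [BorelSpace G], IsCompactSimpleLieGroup G →
      ∀ (r : LatticeRep G), ∃ K' : ℝ,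
        ∀ (β m K : ℝ) (S₀ S₁ : ℕ), 0 ≤ β → 0 < m → m ≤ 1 → 0 ≤ K →
          (∀ S : ℕ, S₀ ≤ S → CylGap r β (2 * S + 1) (m / 2)) →
          (∀ S : ℕ, S₁ ≤ S → ∀ M : ℕ, 2 * S + 1 ≤ 4 * (M + 1) →
              slabZeta r β (M + 1) (2 * S + 1) ≤ 1 + K) →
            ∀ (A B : YMSpecies G) (C_A C_B : ℝ), (∀ U, |A.F U| ≤ C_A) → (∀ U, |B.F U| ≤ C_B) →
              ∀ S : ℕ, max S₀ S₁ ≤ S → ∀ n : ℕ, n ≤ S →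
                |latticeConnectedCorr r.ρ β (2 * S + 1) A.F B.F n| ≤
                  K' * (1 + K) ^ 2 * C_A * C_B * Real.exp ((timeExtent A : ℝ) + timeExtent B) *
                    Real.exp (-(m / 4 * n))

end Statement

/-! ### The registered stubs (sorried) -/

/-- RQ0 (registered stub `stub_cylinderApprox`; type spelled out verbatim = body of `Statement.stub_cylinderApprox`). -/
theorem stub_cylinderApprox :
    ∀ (G : Type) [Group G] [TopologicalSpace G] [IsTopologicalGroup G] [CompactSpace G]
      [MeasurableSpace G] [BorelSpace G], IsCompactSimpleLieGroup G →
        (∀ (μ : Measure (LGConfig 4 G)) [IsProbabilityMeasure μ], CylinderApprox μ) ∧ CylinderExt G := by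
  sorry

/-- RQa (registered stub `stub_reconstructible`; type spelled out verbatim = body of `Statement.stub_reconstructible`). -/
theorem stub_reconstructible :
    ∀ (G : Type) [Group G] [TopologicalSpace G] [IsTopologicalGroup G] [CompactSpace G]
      [MeasurableSpace G] [BorelSpace G], IsCompactSimpleLieGroup G →
        ∀ (r : LatticeRep G) (β : ℝ), 0 ≤ β →
          ∀ (μ : Measure (LGConfig 4 G)) [IsProbabilityMeasure μ], μ ∈ oddTorusLimitPoints r β →
            CylinderApprox μ → CylinderExt G →
              IsOSReconstructible μ gaugeTimeReflect gaugeTimeShift (posTimeEvents G) := by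
  sorry

/-- RQb1 (registered stub `stub_osDensity`; type spelled out verbatim = body of `Statement.stub_osDensity`). -/
theorem stub_osDensity :
    ∀ (G : Type) [Group G] [TopologicalSpace G] [IsTopologicalGroup G] [CompactSpace G]
      [MeasurableSpace G] [BorelSpace G], IsCompactSimpleLieGroup G →
        ∀ (r : LatticeRep G) (β : ℝ), 0 ≤ β →
          ∀ (μ : Measure (LGConfig 4 G)) [IsProbabilityMeasure μ], μ ∈ oddTorusLimitPoints r β →
            CylinderApprox μ →
              ∀ h : IsOSReconstructible μ gaugeTimeReflect gaugeTimeShift (posTimeEvents G),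
                Dense (h.osMap '' (Submodule.span ℂ (contPosTimeObs G) : Set (LGConfig 4 G → ℂ))) := by
  sorry

/-- RQb2 (registered stub `stub_gapFromClustering`; type spelled out verbatim = body of `Statement.stub_gapFromClustering`). -/
theorem stub_gapFromClustering :
    ∀ (G : Type) [Group G] [TopologicalSpace G] [IsTopologicalGroup G] [CompactSpace G]
      [MeasurableSpace G] [BorelSpace G], IsCompactSimpleLieGroup G →
        ∀ (r : LatticeRep G) (β m : ℝ), 0 ≤ β → 0 < m → TorusClusteringAt r β m →
          ∀ (μ : Measure (LGConfig 4 G)) [IsProbabilityMeasure μ], μ ∈ oddTorusLimitPoints r β →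
            ∀ h : IsOSReconstructible μ gaugeTimeReflect gaugeTimeShift (posTimeEvents G),
              Dense (h.osMap '' (Submodule.span ℂ (contPosTimeObs G) : Set (LGConfig 4 G → ℂ))) →
                h.transferData.HasMassGap m := by
  sorry

/-- **RQ from the four RQ-stubs** (checked composition): approximation property and measure
extensionality (RQ0) ⟹ OS-reconstructibility of every odd-torus limit state (RQa) and OS density
of the continuous gauge-invariant positive-time observables (RQb1) ⟹ the gap from H (RQb2). -/
theorem requantise_of_stubs (h0 : Statement.stub_cylinderApprox)
    (ha : Statement.stub_reconstructible) (hb1 : Statement.stub_osDensity)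
    (hb2 : Statement.stub_gapFromClustering) : Statement.stub_requantise := by
  intro G _ _ _ _ _ _ hG r β m hβ hm hEC μ _ hμ
  obtain ⟨hAP, hExt⟩ := h0 G hG
  have h : IsOSReconstructible μ gaugeTimeReflect gaugeTimeShift (posTimeEvents G) :=
    ha G hG r β hβ μ hμ (hAP μ) hExt
  exact ⟨h, hb2 G hG r β m hβ hm hEC μ hμ h (hb1 G hG r β hβ μ hμ (hAP μ) h)⟩

/-- RQ (derived). -/
theorem stub_requantise : Statement.stub_requantise :=
  requantise_of_stubs stub_cylinderApprox stub_reconstructible stub_osDensity stub_gapFromClustering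

/-- GV (registered stub `stub_gapStability`; type spelled out verbatim = body of `Statement.stub_gapStability`). -/
theorem stub_gapStability :
    ∀ (G : Type) [Group G] [TopologicalSpace G] [IsTopologicalGroup G] [CompactSpace G]
      [MeasurableSpace G] [BorelSpace G], IsCompactSimpleLieGroup G →
        ∀ (r : LatticeRep G) (β mH m : ℝ), 0 ≤ β → 0 < mH → TorusClusteringAt r β mH →
          0 < m → m ≤ 1 → HasInfiniteVolumeGap r β m →
            ∃ S₀ : ℕ, ∀ S : ℕ, S₀ ≤ S → CylGap r β (2 * S + 1) (m / 2) := by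
  sorry

/-- T¼ (registered stub `stub_thermalMultiplicity`; type spelled out verbatim = body of `Statement.stub_thermalMultiplicity`). -/
theorem stub_thermalMultiplicity :
    ∀ (G : Type) [Group G] [TopologicalSpace G] [IsTopologicalGroup G] [CompactSpace G]
      [MeasurableSpace G] [BorelSpace G], IsCompactSimpleLieGroup G →
        ∀ (r : LatticeRep G), ∃ K : ℝ, 0 ≤ K ∧
          ∀ (β mH m : ℝ) (S₀ : ℕ), 0 ≤ β → 0 < mH → TorusClusteringAt r β mH →
            0 < m → m ≤ 1 → HasInfiniteVolumeGap r β m →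
            (∀ S : ℕ, S₀ ≤ S → CylGap r β (2 * S + 1) (m / 2)) →
              ∃ S₁ : ℕ, ∀ S : ℕ, S₁ ≤ S → ∀ M : ℕ, 2 * S + 1 ≤ 4 * (M + 1) →
                slabZeta r β (M + 1) (2 * S + 1) ≤ 1 + K := by
  sorry

/-- BD (registered stub `stub_blockDecomposition`; type spelled out verbatim = body of `Statement.stub_blockDecomposition`). -/
theorem stub_blockDecomposition :
    ∀ (G : Type) [Group G] [TopologicalSpace G] [IsTopologicalGroup G] [CompactSpace G]
      [MeasurableSpace G] [BorelSpace G], IsCompactSimpleLieGroup G →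
        ∀ (r : LatticeRep G), ∃ K' : ℝ,
          ∀ (β m K : ℝ) (S₀ S₁ : ℕ), 0 ≤ β → 0 < m → m ≤ 1 → 0 ≤ K →
            (∀ S : ℕ, S₀ ≤ S → CylGap r β (2 * S + 1) (m / 2)) →
            (∀ S : ℕ, S₁ ≤ S → ∀ M : ℕ, 2 * S + 1 ≤ 4 * (M + 1) →
                slabZeta r β (M + 1) (2 * S + 1) ≤ 1 + K) →
              ∀ (A B : YMSpecies G) (C_A C_B : ℝ), (∀ U, |A.F U| ≤ C_A) → (∀ U, |B.F U| ≤ C_B) →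
                ∀ S : ℕ, max S₀ S₁ ≤ S → ∀ n : ℕ, n ≤ S →
                  |latticeConnectedCorr r.ρ β (2 * S + 1) A.F B.F n| ≤
                    K' * (1 + K) ^ 2 * C_A * C_B * Real.exp ((timeExtent A : ℝ) + timeExtent B) *
                      Real.exp (-(m / 4 * n)) := by
  sorry

/-! ### The adapter from the four stubs (real proofs from here on) -/

section Adapter

variable {G : Type} [Group G] [TopologicalSpace G] [IsTopologicalGroup G] [CompactSpace G]
  [MeasurableSpace G] [BorelSpace G]

/-- `HasInfiniteVolumeGap` is antitone in the rate. -/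
theorem ivGap_mono {r : LatticeRep G} {β m m' : ℝ} (hm' : 0 < m') (hle : m' ≤ m)
    (h : HasInfiniteVolumeGap r β m) : HasInfiniteVolumeGap r β m' := by
  intro μ _ hμ
  obtain ⟨hOS, hgap⟩ := h μ hμ
  exact ⟨hOS, hm', hgap.2.trans (Real.exp_le_exp.2 (neg_le_neg hle))⟩

/-- **The spectral rate at `β`**: the supremum `m_*(β)` of the rates `m ≤ 1` with `HasInfiniteVolumeGap r β m` — i.e.
`min 1 (inf over odd-torus limit states of their Osterwalder–Schrader mass gap)` whenever some
positive rate is admissible (junk `sSup ∅` otherwise).  THIS, not H's rate, is what the line feeds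
downstream. -/
def mStar (r : LatticeRep G) (β : ℝ) : ℝ := sSup {m : ℝ | 0 < m ∧ m ≤ 1 ∧ HasInfiniteVolumeGap r β m}

/-- One admissible rate makes `m_*(β)` an admissible rate in `(0, 1]` (the gap condition
`‖T P_{Ω^⊥}‖ ≤ e^{-m}` is closed in `m`). -/
theorem ivGap_mStar {r : LatticeRep G} {β m₀ : ℝ} (hm₀ : 0 < m₀) (hm₀1 : m₀ ≤ 1)
    (h : HasInfiniteVolumeGap r β m₀) : 0 < mStar r β ∧ mStar r β ≤ 1 ∧ HasInfiniteVolumeGap r β (mStar r β) := by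
  have hne : {m : ℝ | 0 < m ∧ m ≤ 1 ∧ HasInfiniteVolumeGap r β m}.Nonempty := ⟨m₀, hm₀, hm₀1, h⟩
  have hbdd : BddAbove {m : ℝ | 0 < m ∧ m ≤ 1 ∧ HasInfiniteVolumeGap r β m} := ⟨1, fun m hm => hm.2.1⟩
  have hle₀ : m₀ ≤ mStar r β := le_csSup hbdd ⟨hm₀, hm₀1, h⟩
  have hpos : 0 < mStar r β := hm₀.trans_le hle₀
  have hle1 : mStar r β ≤ 1 := csSup_le hne fun m hm => hm.2.1
  refine ⟨hpos, hle1, fun μ _ hμ => ?_⟩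
  obtain ⟨hOS, -⟩ := h μ hμ
  refine ⟨hOS, hpos, ?_⟩
  have hall : ∀ m ∈ {m : ℝ | 0 < m ∧ m ≤ 1 ∧ HasInfiniteVolumeGap r β m},
      hOS.transferData.gapNorm ≤ Real.exp (-m) := by
    intro m hm
    obtain ⟨_, hgap⟩ := hm.2.2 μ hμ
    exact hgap.2
  by_contra hlt
  push Not at hlt
  have hgpos : 0 < hOS.transferData.gapNorm := (Real.exp_pos _).trans hlt
  have h1 : -Real.log hOS.transferData.gapNorm < mStar r β := by
    have := Real.log_lt_log (Real.exp_pos _) hlt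
    rw [Real.log_exp] at this
    linarith
  obtain ⟨m, hmE, hm⟩ := exists_lt_of_lt_csSup hne h1
  have h3 : Real.log hOS.transferData.gapNorm ≤ -m := by
    have := Real.log_le_log hgpos (hall m hmE)
    rwa [Real.log_exp] at this
  linarith

/-- **The adapter at the spectral rate, from the four stubs** (`TorusGapUniformisation` of the idea
card, per `(G, r)`): H ⟹ the `β`-uniform large-torus shape of 8762's hypothesis 1, with rate
`m(β) = m_*(β) / 4` — a quarter of the SPECTRAL rate `mStar`, not of H's rate — and `β`-free
structured constants `K' (1+K)² C_A C_B e^{c_A+c_B}`. -/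
theorem uniformTorusGap_of_stubs (hRQ : Statement.stub_requantise)
    (hGV : Statement.stub_gapStability) (hTH : Statement.stub_thermalMultiplicity)
    (hBD : Statement.stub_blockDecomposition) (hG : IsCompactSimpleLieGroup G) (r : LatticeRep G)
    (hH : ∃ β₀ : ℝ, ∀ β : ℝ, β₀ ≤ β → ∃ m : ℝ, 0 < m ∧ TorusClusteringAt r β m) :
    UniformTorusGap r := by
  obtain ⟨β₀, hβ₀⟩ := hH
  obtain ⟨K, hK0, hK⟩ := hTH G hG r
  obtain ⟨K', hK'⟩ := hBD G hG r
  -- per-β data beyond β₁ := max β₀ 0, at the spectral rate mStar r β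
  have hdata : ∀ β : ℝ, max β₀ 0 ≤ β → 0 < mStar r β ∧ ∃ S₂ : ℕ,
      ∀ (A B : YMSpecies G) (C_A C_B : ℝ), (∀ U, |A.F U| ≤ C_A) → (∀ U, |B.F U| ≤ C_B) →
        ∀ S : ℕ, S₂ ≤ S → ∀ n : ℕ, n ≤ S →
          |latticeConnectedCorr r.ρ β (2 * S + 1) A.F B.F n| ≤
            K' * (1 + K) ^ 2 * C_A * C_B * Real.exp ((timeExtent A : ℝ) + timeExtent B) *
              Real.exp (-(mStar r β / 4 * n)) := by
    intro β hβ
    have hβ0 : 0 ≤ β := le_trans (le_max_right _ _) hβ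
    obtain ⟨m₀, hm₀, hEC⟩ := hβ₀ β (le_trans (le_max_left _ _) hβ)
    -- re-quantise at H's rate, cap at 1, pass to the spectral rate
    have hIV₀ : HasInfiniteVolumeGap r β m₀ := hRQ G hG r β m₀ hβ0 hm₀ hEC
    have hIV₁ : HasInfiniteVolumeGap r β (min m₀ 1) := ivGap_mono (lt_min hm₀ one_pos) (min_le_left _ _) hIV₀
    obtain ⟨hpos, hle1, hIV⟩ := ivGap_mStar (lt_min hm₀ one_pos) (min_le_right _ _) hIV₁
    obtain ⟨S₀, hS₀⟩ := hGV G hG r β m₀ (mStar r β) hβ0 hm₀ hEC hpos hle1 hIV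
    obtain ⟨S₁, hS₁⟩ := hK β m₀ (mStar r β) S₀ hβ0 hm₀ hEC hpos hle1 hIV hS₀
    exact ⟨hpos, max S₀ S₁, fun A B C_A C_B hA hB S hS n hn =>
      hK' β (mStar r β) K S₀ S₁ hβ0 hpos hle1 hK0 hS₀ hS₁ A B C_A C_B hA hB S hS n hn⟩
  choose hm S₂ hS₂ using hdata
  refine ⟨max β₀ 0, fun β => mStar r β / 4, fun β => if hβ : max β₀ 0 ≤ β then S₂ β hβ else 0,
    fun β hβ => by have := hm β hβ; positivity, ?_⟩
  intro A B
  obtain ⟨C_A, hA⟩ := A.bounded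
  obtain ⟨C_B, hB⟩ := B.bounded
  refine ⟨K' * (1 + K) ^ 2 * C_A * C_B * Real.exp ((timeExtent A : ℝ) + timeExtent B),
    fun β hβ S n hS hn => ?_⟩
  simp only [hβ, ↓reduceDIte] at hS
  have h := hS₂ β hβ A B C_A C_B hA hB S hS n hn
  have hrate : -(mStar r β / 4 * (n : ℝ)) = -(mStar r β / 4 * n) := rfl
  simpa only [hrate] using h

/-- The crux's hypothesis H as one Prop (verbatim the antecedent of `ClusteringToYangMills`, = the
standing disprover's `LatticeClustering`; re-declared because `Disproof.lean` is a work file, not a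
module). -/
def HGlobal : Prop :=
  ∀ (G : Type) [Group G] [TopologicalSpace G] [IsTopologicalGroup G] [CompactSpace G]
    [MeasurableSpace G] [BorelSpace G], IsCompactSimpleLieGroup G →
      ∀ r : LatticeRep G, ∃ β₀ : ℝ, ∀ β : ℝ, β₀ ≤ β → ∃ m : ℝ, 0 < m ∧ TorusClusteringAt r β m

/-- Read-back (definitional): the crux is `HGlobal → YangMills`. -/
theorem crux_iff' : Theses.FradkinShenkerFlow.ClusteringToYangMills ↔ (HGlobal → YangMills) :=
  Iff.rfl

/-- The adapter as ONE Prop over all simple `G` and faithful `r` (the idea card's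
`TorusGapUniformisation`, whose antecedent per `(G, r)` is literally the crux's). -/
def TorusGapUniformisation : Prop :=
  ∀ (G : Type) [Group G] [TopologicalSpace G] [IsTopologicalGroup G] [CompactSpace G]
    [MeasurableSpace G] [BorelSpace G], IsCompactSimpleLieGroup G → ∀ r : LatticeRep G,
      (∃ β₀ : ℝ, ∀ β : ℝ, β₀ ≤ β → ∃ m : ℝ, 0 < m ∧ TorusClusteringAt r β m) → UniformTorusGap r

omit [Group G] [TopologicalSpace G] [IsTopologicalGroup G] [CompactSpace G] [MeasurableSpace G]
  [BorelSpace G] in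
/-- The four stubs prove the adapter. -/
theorem torusGapUniformisation_of_stubs (hRQ : Statement.stub_requantise)
    (hGV : Statement.stub_gapStability) (hTH : Statement.stub_thermalMultiplicity)
    (hBD : Statement.stub_blockDecomposition) : TorusGapUniformisation :=
  fun _ _ _ _ _ _ _ hG r hH => uniformTorusGap_of_stubs hRQ hGV hTH hBD hG r hH

end Adapter

/-! ### The composition: the crux from the four stubs and the three sibling items -/

/-- **`ClusteringToYangMills` from the seven registered stubs and the three sibling items**
(kernel-checked, no `sorry` here).  This IS the idea card's certified `dock`, with the adapter
discharged by `torusGapUniformisation_of_stubs`: H per `(G, r)` is uniformised at the spectral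
rate, criticality of every admissible rate is supplied independently of H by
`CriticalityOfXiDiverges XiDiverges` (items 12318, 8941), and `CriticalContinuumLimit` (item 8762,
the canonical UV/OS leg) returns the witness clause of `YangMills`.  The three items are registered
obligations of routes DirichletWindow / XiCompleteMonotonicity / EquipartitionCriticality; this is
the ONLY theorem of the file concluding the crux by name. -/
theorem ClusteringToYangMills_of :
    Statement.stub_cylinderApprox → Statement.stub_reconstructible → Statement.stub_osDensity →
      Statement.stub_gapFromClustering →
      Statement.stub_gapStability → Statement.stub_thermalMultiplicity →
      Statement.stub_blockDecomposition →
      Theses.DirichletWindow.XiDiverges → Theses.DirichletWindow.CriticalityOfXiDiverges →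
      Theses.EquipartitionCriticality.CriticalContinuumLimit →
        Theses.FradkinShenkerFlow.ClusteringToYangMills := by
  intro h0 ha hb1 hb2 hGV hTH hBD hXi hCrit hCCL hH G _ _ _ _ hG
  letI : MeasurableSpace G := borel G
  haveI : BorelSpace G := ⟨rfl⟩
  have hRQ : Statement.stub_requantise := requantise_of_stubs h0 ha hb1 hb2
  have hU : TorusGapUniformisation := torusGapUniformisation_of_stubs hRQ hGV hTH hBD
  have h1 : ∀ r : LatticeRep G, UniformTorusGap r := fun r => hU G hG r (hH G hG r)
  exact hCCL G hG h1 (hCrit hXi G hG)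

/-- The dock in the idea card's shape, for the record: the adapter ALONE (however proved) plus the
three sibling items give the crux — stated with the crux unfolded one step (`H → YangMills`,
definitionally the crux, cf. the disprover's `crux_iff`) so that the skeleton audit sees exactly
one theorem concluding the crux by name. -/
theorem dock (hU : TorusGapUniformisation)
    (hXi : Theses.DirichletWindow.XiDiverges)
    (hCrit : Theses.DirichletWindow.CriticalityOfXiDiverges)
    (hCCL : Theses.EquipartitionCriticality.CriticalContinuumLimit) :
    HGlobal → YangMills := by
  intro hH G _ _ _ _ hG
  letI : MeasurableSpace G := borel G
  haveI : BorelSpace G := ⟨rfl⟩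
  have h1 : ∀ r : LatticeRep G, UniformTorusGap r := fun r => hU G hG r (hH G hG r)
  exact hCCL G hG h1 (hCrit hXi G hG)

/-- The crux modulo the registered stubs and the three sibling items (here `sorry` enters, through
the stubs only). -/
example (h8941 : Theses.DirichletWindow.XiDiverges)
    (h12318 : Theses.DirichletWindow.CriticalityOfXiDiverges)
    (h8762 : Theses.EquipartitionCriticality.CriticalContinuumLimit) :
    Theses.FradkinShenkerFlow.ClusteringToYangMills :=
  ClusteringToYangMills_of stub_cylinderApprox stub_reconstructible stub_osDensity
    stub_gapFromClustering stub_gapStability stub_thermalMultiplicity stub_blockDecomposition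
    h8941 h12318 h8762

end Summit.QuantumFields.YangMills.Cruxes.ClusteringToYangMills.SpectralRequantisationDock

end
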